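import Literature.AlgebraicGeometry.Deformation.SmoothSchemeLiftObstructionFunctorialRep
import Literature.AlgebraicGeometry.Deformation.SmoothSchemeLiftObstructionLocalizeMap
import Literature.AlgebraicGeometry.Deformation.SmoothSchemeLiftObstructionCechCocycle
import Literature.AlgebraicGeometry.HodgeTheory.CotangentSheafAffineSemilinearLift
import Literature.AlgebraicGeometry.HodgeTheory.CotangentSheafComap
import Literature.AlgebraicGeometry.HodgeTheory.HodgeSheafPullbackForms
import HarnessLib

/-!
# Čech bookkeeping of the functoriality of the obstruction class, I: restriction of chart lifts and the pair data
# (Hartshorne, *Deformation Theory*, proof of Thm. 10.2; Illusie: «the obstruction is functorial»; Oort 1971 §2.2)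

Layer `Literature/AlgebraicGeometry/Deformation`, namespace `Literature.AlgebraicGeometry.Deformation` (THEOREMS only: no
definition, no instance, no notation, no named fact).  First of three files (`…FunctorialCechRestrict` ⧺ `…FunctorialCechForms`
→ `…FunctorialCech`, the head `exists_cechMD1_eq_comap_obstruction_sub`).  In the currency of ★ F2
`SmoothSchemeLiftObstructionCechCocycle` (principal affine cover `U`, `U_j ∩ U_l = D(b j l)`; principal small extension `J ≅ k`;
lifted transition automorphisms `ψ ≡ 1 (mod 𝔫')`, `𝔫'` nilpotent) for BOTH sides of a morphism `f : Y → X` over `Spec k`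
(`Y`-side cover `U′_j = f⁻¹U_j`), with chart lifts `F_j : A' ⊗ Γ(X, U_j) → A' ⊗ Γ(Y, U′_j)` of `f♯`:

* §1 `f♯` respects the `k`-structures (`appLE_algebraMap_eq_algebraMap`, from ★ `HodgeTheory.appLE_constToPresheaf`); RESTRICTION OF CHART LIFTS along principal opens
  (`exists_algHom_restrict₂`, scheme wrapper of ★ `exists_algHom_localization₂`) and transport of mod-`I` agreement
  (`sub_mem_restrict_of_forall`, wrapper of ★ `sub_mem_of_comp_map_of_forall`);
* §2 auxiliaries: uniqueness of restrictions (`algHom_restrict_ext`), `Φ(I·x) ⊆ I` (`algHom_map_mem_smul_top`), the preimage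
  cover is principal (`inf_eq_basicOpen_appLE`);
* §3 THE PAIR DATA on `U_j ∩ U_l` (`exists_pairData`): restricted lifts `F_j^{jl}, F_l^{jl}`, the defect coordinate `δ_{jl}`
  (★ `exists_defectCoord`) and its `1`-form reading `ℓ_{jl}` (★ `exists_semilinear_lift_of_leibniz`);
* §4 two restrictions of one chart lift to a common smaller principal open coincide (`algHom_restrict_restrict_eq`).

Cell `hodgecm-mathlib` (D-0151), F-11 α1 / J4-(iv) road (a′) brick (iv-1b) FILE B2 (B-p08 (g16); F0P1b-plan (R34); F0P1b-p05 FIT LIST slot (3)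
rel₁).  HC_CM is proved only modulo the 7 printed citations until rung 0 closes — nothing here bears on a summit statement.

## References
* [Hartshorne2010] R. Hartshorne, *Deformation Theory*, GTM 257, Springer (2010): Thm. 10.2 (a) and its proof (p. 81),
  Remark 10.1.1 (p. 80), Cor. 10.3 (p. 82).
* [Hartshorne1977] R. Hartshorne, *Algebraic Geometry* (1977): II.8 p. 172, II Remark 8.9.2 (p. 175), III §4 p. 218.
* (prose only) L. Illusie, in *FGA Explained*, AMS (2005), §8.5; F. Oort, Compositio Math. 23 (1971), §2.2.
-/

noncomputable section

-- `TopCat.Presheaf`/`Scheme.Modules` are not reducible (as in ★ F2 `SmoothSchemeLiftObstructionCechCocycle`).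
set_option backward.isDefEq.respectTransparency false

open CategoryTheory AlgebraicGeometry Opposite TopologicalSpace
open scoped TensorProduct

universe u

namespace Literature.AlgebraicGeometry.Deformation

open Literature.AlgebraicGeometry.HodgeTheory Literature.AlgebraicGeometry.Modules
  Literature.AlgebraicGeometry.Motives Literature.AlgebraicGeometry.Morphisms SmoothAffineDeformation

variable {k : Type u} [Field k] {X Y : Over (Spec (CommRingCat.of k))}
  [instΓX : ∀ W : X.left.Opens, Algebra k Γ(X.left, W)] [instΓY : ∀ W : Y.left.Opens, Algebra k Γ(Y.left, W)]
  (halgX : ∀ (W : X.left.Opens) (s : k), algebraMap k Γ(X.left, W) s = (constToPresheaf X).app (op W) s)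
  (halgY : ∀ (W : Y.left.Opens) (s : k), algebraMap k Γ(Y.left, W) s = (constToPresheaf Y).app (op W) s)
  (f : Y ⟶ X)

/-! ## §1 `f♯` respects the `k`-structures; restriction of chart lifts along principal opens -/

include halgX halgY in
/-- `f♯ : Γ(X, V) → Γ(Y, V′)` commutes with the `k`-structures fixed by `halgX`, `halgY`. [cite: Hartshorne1977, II.8 p. 172] -/
theorem appLE_algebraMap_eq_algebraMap {V : X.left.Opens} {V' : Y.left.Opens} (hVV' : V' ≤ f.left ⁻¹ᵁ V) (s : k) :
    f.left.appLE V V' hVV' (algebraMap k Γ(X.left, V) s) = algebraMap k Γ(Y.left, V') s := by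
  rw [halgX, halgY, appLE_constToPresheaf f V V' hVV' s]

include halgX in
/-- The restriction `Γ(X, V) → Γ(X, W)` commutes with the `k`-structures (local helper, as the private copy in ★ F2;
cf. ★ `Motives.FieldNorm.map_algebraMap_sec` for the structure-map instance). [cite: Hartshorne1977, II.8 p. 172] -/
private theorem map_algebraMap_of_le' {V W : X.left.Opens} (h : W ≤ V) (s : k) :
    X.left.presheaf.map (homOfLE h).op (algebraMap k Γ(X.left, V) s) = algebraMap k Γ(X.left, W) s := by
  rw [halgX, halgX, map_constToPresheaf_app_of_le]

variable {A' : Type u} [CommRing A'] [Algebra k A'] (𝔫' : Ideal A')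

include halgX halgY in
/-- **Restriction of a chart lift along principal opens** (★ `exists_algHom_localization₂` in scheme currency): `V ⊆ X`,
`V′ ⊆ f⁻¹V ⊆ Y` affine, `W = D(s) ⊆ V`, `W′ = D(f♯ s) ⊆ V′`; an `A'`-algebra map `F : A' ⊗ Γ(X, V) → A' ⊗ Γ(Y, V′)` reducing to
`1 ⊗ f♯` modulo the NILPOTENT `𝔫'` restricts to `F_W : A' ⊗ Γ(X, W) → A' ⊗ Γ(Y, W′)`, compatible with the base-change maps and
again `≡ 1 ⊗ f♯ (mod 𝔫')`. [cite: Hartshorne2010, Thm. 10.2 (proof), p. 81 («restricting to `U_{ijk}`»)] -/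
theorem exists_algHom_restrict₂ {V W : X.left.Opens} (hV : IsAffineOpen V) (s : Γ(X.left, V))
    (hW : W = X.left.basicOpen s) (h : W ≤ V) {V' W' : Y.left.Opens} (hV' : IsAffineOpen V')
    (hVV' : V' ≤ f.left ⁻¹ᵁ V) (hW' : W' = Y.left.basicOpen (f.left.appLE V V' hVV' s)) (h' : W' ≤ V')
    (hWW' : W' ≤ f.left ⁻¹ᵁ W) (h𝔫 : IsNilpotent 𝔫')
    (F : A' ⊗[k] Γ(X.left, V) →ₐ[A'] A' ⊗[k] Γ(Y.left, V'))
    (hF : ∀ c, F ((1 : A') ⊗ₜ c) - (1 : A') ⊗ₜ f.left.appLE V V' hVV' c ∈ 𝔫' • (⊤ : Submodule A' (A' ⊗[k] Γ(Y.left, V'))))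
    {ΦX : A' ⊗[k] Γ(X.left, V) →ₐ[A'] A' ⊗[k] Γ(X.left, W)}
    (hΦX : ∀ a c, ΦX (a ⊗ₜ c) = a ⊗ₜ X.left.presheaf.map (homOfLE h).op c)
    {ΦY : A' ⊗[k] Γ(Y.left, V') →ₐ[A'] A' ⊗[k] Γ(Y.left, W')}
    (hΦY : ∀ a c, ΦY (a ⊗ₜ c) = a ⊗ₜ Y.left.presheaf.map (homOfLE h').op c) :
    ∃ FW : A' ⊗[k] Γ(X.left, W) →ₐ[A'] A' ⊗[k] Γ(Y.left, W'),
      (∀ x, FW (ΦX x) = ΦY (F x)) ∧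
        ∀ c, FW ((1 : A') ⊗ₜ c) - (1 : A') ⊗ₜ f.left.appLE W W' hWW' c ∈
          𝔫' • (⊤ : Submodule A' (A' ⊗[k] Γ(Y.left, W'))) := by
  subst hW hW'
  -- the two localisations
  letI algX : Algebra Γ(X.left, V) Γ(X.left, X.left.basicOpen s) := (X.left.presheaf.map (homOfLE h).op).hom.toAlgebra
  haveI : IsScalarTower k Γ(X.left, V) Γ(X.left, X.left.basicOpen s) :=
    IsScalarTower.of_algebraMap_eq fun c => (map_algebraMap_of_le' halgX h c).symm
  haveI : IsLocalization.Away s Γ(X.left, X.left.basicOpen s) := hV.isLocalization_basicOpen s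
  letI algY : Algebra Γ(Y.left, V') Γ(Y.left, Y.left.basicOpen (f.left.appLE V V' hVV' s)) :=
    (Y.left.presheaf.map (homOfLE h').op).hom.toAlgebra
  haveI : IsScalarTower k Γ(Y.left, V') Γ(Y.left, Y.left.basicOpen (f.left.appLE V V' hVV' s)) :=
    IsScalarTower.of_algebraMap_eq fun c => (map_algebraMap_of_le' halgY h' c).symm
  haveI : IsLocalization.Away (f.left.appLE V V' hVV' s) Γ(Y.left, Y.left.basicOpen (f.left.appLE V V' hVV' s)) :=
    hV'.isLocalization_basicOpen _
  -- `f♯` on `V` as a `k`-algebra map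
  let g : Γ(X.left, V) →ₐ[k] Γ(Y.left, V') :=
    { (f.left.appLE V V' hVV').hom with commutes' := fun c => appLE_algebraMap_eq_algebraMap halgX halgY f hVV' c }
  have hg : ∀ c, g c = f.left.appLE V V' hVV' c := fun _ => rfl
  have hΦX' : ∀ x, ΦX x = Algebra.TensorProduct.map (AlgHom.id A' A')
      (IsScalarTower.toAlgHom k Γ(X.left, V) Γ(X.left, X.left.basicOpen s)) x :=
    AlgHom.congr_fun (Algebra.TensorProduct.ext' fun a c => by
      rw [hΦX, Algebra.TensorProduct.map_tmul, AlgHom.id_apply, IsScalarTower.coe_toAlgHom']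
      rfl)
  have hΦY' : ∀ x, ΦY x = Algebra.TensorProduct.map (AlgHom.id A' A')
      (IsScalarTower.toAlgHom k Γ(Y.left, V') Γ(Y.left, Y.left.basicOpen (f.left.appLE V V' hVV' s))) x :=
    AlgHom.congr_fun (Algebra.TensorProduct.ext' fun a c => by
      rw [hΦY, Algebra.TensorProduct.map_tmul, AlgHom.id_apply, IsScalarTower.coe_toAlgHom']
      rfl)
  have hunit : ∀ t : Submonoid.powers s, IsUnit (algebraMap Γ(Y.left, V') Γ(Y.left, Y.left.basicOpen (f.left.appLE V V' hVV' s)) (g (t : Γ(X.left, V)))) := by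
    rintro ⟨_, n, rfl⟩
    rw [hg, map_pow, map_pow]
    exact (IsLocalization.Away.algebraMap_isUnit (f.left.appLE V V' hVV' s)).pow n
  obtain ⟨FW, hFW⟩ := exists_algHom_localization₂ (Bs := Γ(X.left, X.left.basicOpen s))
    (Ct := Γ(Y.left, Y.left.basicOpen (f.left.appLE V V' hVV' s))) 𝔫' (Submonoid.powers s) h𝔫 F g hF hunit
  -- `f♯` on `W` is compatible with `f♯` on `V`
  let gs : Γ(X.left, X.left.basicOpen s) →ₐ[k] Γ(Y.left, Y.left.basicOpen (f.left.appLE V V' hVV' s)) :=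
    { (f.left.appLE (X.left.basicOpen s) (Y.left.basicOpen (f.left.appLE V V' hVV' s)) hWW').hom with
      commutes' := fun c => appLE_algebraMap_eq_algebraMap halgX halgY f hWW' c }
  have hgs : ∀ c : Γ(X.left, V), gs (algebraMap Γ(X.left, V) Γ(X.left, X.left.basicOpen s) c) =
      algebraMap Γ(Y.left, V') Γ(Y.left, Y.left.basicOpen (f.left.appLE V V' hVV' s)) (g c) := fun c => by
    change f.left.appLE _ _ hWW' (X.left.presheaf.map (homOfLE h).op c) =
      Y.left.presheaf.map (homOfLE h').op (f.left.appLE V V' hVV' c)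
    rw [← CommRingCat.comp_apply, Scheme.Hom.map_appLE, ← CommRingCat.comp_apply, Scheme.Hom.appLE_map]
  refine ⟨FW, fun x => by rw [hΦX', hΦY']; exact hFW x, fun c => ?_⟩
  have key := sub_mem_of_comp_map₂ (Bs := Γ(X.left, X.left.basicOpen s)) (Ct := Γ(Y.left, Y.left.basicOpen (f.left.appLE V V' hVV' s))) 𝔫'
    (Submonoid.powers s) F g hF gs hgs FW hFW ((1 : A') ⊗ₜ c)
  rwa [Algebra.TensorProduct.map_tmul, AlgHom.id_apply] at key

omit instΓY in
include halgX in
/-- **Two `A'`-algebra maps out of `A' ⊗ Γ(X, D(s))` that agree modulo an ideal `I ⊆ A'` on the image of `A' ⊗ Γ(X, V)` agree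
modulo `I` everywhere** (★ `sub_mem_of_comp_map_of_forall` in scheme currency).
[cite: Hartshorne2010, Thm. 10.2 (proof), p. 81] -/
theorem sub_mem_restrict_of_forall {V W : X.left.Opens} (hV : IsAffineOpen V) (s : Γ(X.left, V))
    (hW : W = X.left.basicOpen s) (h : W ≤ V) (I : Ideal A') {D : Type u} [CommRing D] [Algebra A' D]
    {ΦX : A' ⊗[k] Γ(X.left, V) →ₐ[A'] A' ⊗[k] Γ(X.left, W)}
    (hΦX : ∀ a c, ΦX (a ⊗ₜ c) = a ⊗ₜ X.left.presheaf.map (homOfLE h).op c)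
    (P Q : A' ⊗[k] Γ(X.left, W) →ₐ[A'] D) (hPQ : ∀ x, P (ΦX x) - Q (ΦX x) ∈ I • (⊤ : Submodule A' D))
    (y : A' ⊗[k] Γ(X.left, W)) : P y - Q y ∈ I • (⊤ : Submodule A' D) := by
  subst hW
  letI algX : Algebra Γ(X.left, V) Γ(X.left, X.left.basicOpen s) := (X.left.presheaf.map (homOfLE h).op).hom.toAlgebra
  haveI : IsScalarTower k Γ(X.left, V) Γ(X.left, X.left.basicOpen s) :=
    IsScalarTower.of_algebraMap_eq fun c => (map_algebraMap_of_le' halgX h c).symm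
  haveI : IsLocalization.Away s Γ(X.left, X.left.basicOpen s) := hV.isLocalization_basicOpen s
  have hΦX' : ∀ x, ΦX x = Algebra.TensorProduct.map (AlgHom.id A' A')
      (IsScalarTower.toAlgHom k Γ(X.left, V) Γ(X.left, X.left.basicOpen s)) x :=
    AlgHom.congr_fun (Algebra.TensorProduct.ext' fun a c => by
      rw [hΦX, Algebra.TensorProduct.map_tmul, AlgHom.id_apply, IsScalarTower.coe_toAlgHom']
      rfl)
  exact sub_mem_of_comp_map_of_forall (Bs := Γ(X.left, X.left.basicOpen s)) (Submonoid.powers s) I P Q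
    (fun x => by rw [← hΦX']; exact hPQ x) y

/-! ## §2 Auxiliaries: restriction uniqueness, images of `J`-multiples, the principal cover `f⁻¹U` -/

section Aux

omit instΓY in
include halgX in
/-- **Two `A'`-algebra maps out of `A' ⊗ Γ(X, D(s))` that agree on the image of `A' ⊗ Γ(X, V)` are equal** (maps out of a
localisation). [cite: Hartshorne2010, Thm. 10.2 (proof), p. 81] -/
theorem algHom_restrict_ext {V W : X.left.Opens} (hV : IsAffineOpen V) (s : Γ(X.left, V))
    (hW : W = X.left.basicOpen s) (h : W ≤ V) {D : Type u} [CommRing D] [Algebra A' D]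
    {ΦX : A' ⊗[k] Γ(X.left, V) →ₐ[A'] A' ⊗[k] Γ(X.left, W)}
    (hΦX : ∀ a c, ΦX (a ⊗ₜ c) = a ⊗ₜ X.left.presheaf.map (homOfLE h).op c)
    {P Q : A' ⊗[k] Γ(X.left, W) →ₐ[A'] D} (hPQ : ∀ x, P (ΦX x) = Q (ΦX x)) (y : A' ⊗[k] Γ(X.left, W)) :
    P y = Q y := by
  have h0 := sub_mem_restrict_of_forall halgX hV s hW h (⊥ : Ideal A') hΦX P Q
    (fun x => by rw [hPQ, sub_self]; exact Submodule.zero_mem _) y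
  rw [Submodule.bot_smul] at h0
  exact sub_eq_zero.mp ((Submodule.mem_bot A').mp h0)

omit instΓX instΓY in
/-- An `A'`-algebra map sends `I`-multiples to `I`-multiples. [cite: Hartshorne2010, Thm. 10.2 (proof), p. 81] -/
theorem algHom_map_mem_smul_top {R S : Type u} [CommRing R] [CommRing S] [Algebra A' R] [Algebra A' S] (I : Ideal A')
    (Φ : R →ₐ[A'] S) {x : R} (hx : x ∈ I • (⊤ : Submodule A' R)) : Φ x ∈ I • (⊤ : Submodule A' S) := by
  refine Submodule.smul_induction_on hx (fun a ha y _ => ?_) (fun x y hx hy => ?_)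
  · rw [map_smul]
    exact Submodule.smul_mem_smul ha Submodule.mem_top
  · rw [map_add]
    exact Submodule.add_mem _ hx hy

omit instΓX instΓY in
/-- **The preimage cover is principal**: `f⁻¹U_j ∩ f⁻¹U_l = D(f♯ b_{jl})` when `U_j ∩ U_l = D(b_{jl})`
(Mathlib `Scheme.basicOpen_appLE`). [cite: Hartshorne1977, III §4 p. 218 (the affine cover and its intersections)] -/
theorem inf_eq_basicOpen_appLE {ι : Type u} (U : ι → X.left.affineOpens) (b : (j l : ι) → Γ(X.left, (U j).1))
    (hb : ∀ j l, (U j).1 ⊓ (U l).1 = X.left.basicOpen (b j l))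
    (U' : ι → Y.left.affineOpens) (hU' : ∀ j, (U' j).1 = f.left ⁻¹ᵁ (U j).1) (j l : ι) :
    (U' j).1 ⊓ (U' l).1 = Y.left.basicOpen (f.left.appLE (U j).1 (U' j).1 (hU' j).le (b j l)) := by
  rw [Scheme.basicOpen_appLE, ← hb, Scheme.Hom.preimage_inf, ← hU' j, ← hU' l, ← inf_assoc, inf_idem]

end Aux

/-! ## §3 The pair data: restricted lifts, defect coordinates and their `1`-form readings on each overlap -/

section Pair

variable (J 𝔫' : Ideal A') (hJ : J * J = ⊥) (hJ𝔫 : J * 𝔫' = ⊥) (h𝔫 : IsNilpotent 𝔫')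
  (e : ↥(J.restrictScalars k) ≃ₗ[k] k)
  {ι : Type u} (U : ι → X.left.affineOpens) (b : (j l : ι) → Γ(X.left, (U j).1))
  (hb : ∀ j l, (U j).1 ⊓ (U l).1 = X.left.basicOpen (b j l))
  (U' : ι → Y.left.affineOpens) (hU' : ∀ j, (U' j).1 = f.left ⁻¹ᵁ (U j).1)

omit instΓX instΓY in
include hU' in
/-- `U′_j ∩ U′_l ⊆ f⁻¹(U_j ∩ U_l)`. [cite: Hartshorne1977, III §4 p. 218] -/
theorem inf₂_le_preimage (j l : ι) : (U' j).1 ⊓ (U' l).1 ≤ f.left ⁻¹ᵁ ((U j).1 ⊓ (U l).1) := by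
  rw [hU' j, hU' l]; exact le_rfl

omit instΓX instΓY in
include hU' in
/-- `U′_j ∩ U′_l ∩ U′_m ⊆ f⁻¹(U_j ∩ U_l ∩ U_m)`. [cite: Hartshorne1977, III §4 p. 218] -/
theorem inf₃_le_preimage (j l m : ι) :
    (U' j).1 ⊓ (U' l).1 ⊓ (U' m).1 ≤ f.left ⁻¹ᵁ ((U j).1 ⊓ (U l).1 ⊓ (U m).1) := by
  rw [hU' j, hU' l, hU' m]; exact le_rfl

include halgX halgY hJ hJ𝔫 h𝔫 hb hU' in
/-- **THE PAIR DATA on `U_j ∩ U_l`.**  Given chart lifts `F_j, F_l` reducing to `1 ⊗ f♯` modulo `𝔫'` and the mod-`J`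
intertwining hypothesis (F2-style, over characterised restrictions), there are: base-change maps `Φ`, the restrictions
`F_j^{jl}, F_l^{jl}` of the chart lifts to the overlap (★ `exists_algHom_restrict₂`), the DEFECT COORDINATE `δ_{jl}` of the pair
(★ `exists_defectCoord`) and its `1`-FORM READING `ℓ_{jl}` (★ `exists_semilinear_lift_of_leibniz`). [cite: Hartshorne2010, Thm. 10.2 (proof), p. 81] -/
theorem exists_pairData
    (ψX : (j l : ι) → A' ⊗[k] Γ(X.left, (U j).1 ⊓ (U l).1) ≃ₐ[A'] A' ⊗[k] Γ(X.left, (U j).1 ⊓ (U l).1))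
    (ψY : (j l : ι) → A' ⊗[k] Γ(Y.left, (U' j).1 ⊓ (U' l).1) ≃ₐ[A'] A' ⊗[k] Γ(Y.left, (U' j).1 ⊓ (U' l).1))
    (hψY : ∀ j l x, ψY j l x - x ∈ 𝔫' • (⊤ : Submodule A' (A' ⊗[k] Γ(Y.left, (U' j).1 ⊓ (U' l).1))))
    (F : (j : ι) → A' ⊗[k] Γ(X.left, (U j).1) →ₐ[A'] A' ⊗[k] Γ(Y.left, (U' j).1))
    (hF : ∀ j (c : Γ(X.left, (U j).1)),
      F j ((1 : A') ⊗ₜ c) - (1 : A') ⊗ₜ f.left.appLE (U j).1 (U' j).1 (hU' j).le c ∈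
        𝔫' • (⊤ : Submodule A' (A' ⊗[k] Γ(Y.left, (U' j).1))))
    (hFψ : ∀ (j l : ι)
      (ΦXj : A' ⊗[k] Γ(X.left, (U j).1) →ₐ[A'] A' ⊗[k] Γ(X.left, (U j).1 ⊓ (U l).1))
      (_ : ∀ a s, ΦXj (a ⊗ₜ s) = a ⊗ₜ X.left.presheaf.map (homOfLE inf_le_left).op s)
      (ΦXl : A' ⊗[k] Γ(X.left, (U l).1) →ₐ[A'] A' ⊗[k] Γ(X.left, (U j).1 ⊓ (U l).1))
      (_ : ∀ a s, ΦXl (a ⊗ₜ s) = a ⊗ₜ X.left.presheaf.map (homOfLE inf_le_right).op s)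
      (ΦYj : A' ⊗[k] Γ(Y.left, (U' j).1) →ₐ[A'] A' ⊗[k] Γ(Y.left, (U' j).1 ⊓ (U' l).1))
      (_ : ∀ a s, ΦYj (a ⊗ₜ s) = a ⊗ₜ Y.left.presheaf.map (homOfLE inf_le_left).op s)
      (ΦYl : A' ⊗[k] Γ(Y.left, (U' l).1) →ₐ[A'] A' ⊗[k] Γ(Y.left, (U' j).1 ⊓ (U' l).1))
      (_ : ∀ a s, ΦYl (a ⊗ₜ s) = a ⊗ₜ Y.left.presheaf.map (homOfLE inf_le_right).op s)
      (Fj Fl : A' ⊗[k] Γ(X.left, (U j).1 ⊓ (U l).1) →ₐ[A'] A' ⊗[k] Γ(Y.left, (U' j).1 ⊓ (U' l).1)),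
      (∀ x, Fj (ΦXj x) = ΦYj (F j x)) → (∀ x, Fl (ΦXl x) = ΦYl (F l x)) →
      ∀ c : Γ(X.left, (U j).1 ⊓ (U l).1),
        Fl (ψX j l ((1 : A') ⊗ₜ c)) - ψY j l (Fj ((1 : A') ⊗ₜ c)) ∈
          J • (⊤ : Submodule A' (A' ⊗[k] Γ(Y.left, (U' j).1 ⊓ (U' l).1))))
    (j l : ι) :
    ∃ (ΦXj : A' ⊗[k] Γ(X.left, (U j).1) →ₐ[A'] A' ⊗[k] Γ(X.left, (U j).1 ⊓ (U l).1))
      (ΦXl : A' ⊗[k] Γ(X.left, (U l).1) →ₐ[A'] A' ⊗[k] Γ(X.left, (U j).1 ⊓ (U l).1))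
      (ΦYj : A' ⊗[k] Γ(Y.left, (U' j).1) →ₐ[A'] A' ⊗[k] Γ(Y.left, (U' j).1 ⊓ (U' l).1))
      (ΦYl : A' ⊗[k] Γ(Y.left, (U' l).1) →ₐ[A'] A' ⊗[k] Γ(Y.left, (U' j).1 ⊓ (U' l).1))
      (Fj Fl : A' ⊗[k] Γ(X.left, (U j).1 ⊓ (U l).1) →ₐ[A'] A' ⊗[k] Γ(Y.left, (U' j).1 ⊓ (U' l).1))
      (δ : Γ(X.left, (U j).1 ⊓ (U l).1) → Γ(Y.left, (U' j).1 ⊓ (U' l).1))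
      (ℓ : Γ(cotangentSheaf X, (U j).1 ⊓ (U l).1) →+ Γ(Y.left, (U' j).1 ⊓ (U' l).1)),
      (∀ a s, ΦXj (a ⊗ₜ s) = a ⊗ₜ X.left.presheaf.map (homOfLE inf_le_left).op s) ∧
      (∀ a s, ΦXl (a ⊗ₜ s) = a ⊗ₜ X.left.presheaf.map (homOfLE inf_le_right).op s) ∧
      (∀ a s, ΦYj (a ⊗ₜ s) = a ⊗ₜ Y.left.presheaf.map (homOfLE inf_le_left).op s) ∧
      (∀ a s, ΦYl (a ⊗ₜ s) = a ⊗ₜ Y.left.presheaf.map (homOfLE inf_le_right).op s) ∧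
      (∀ x, Fj (ΦXj x) = ΦYj (F j x)) ∧ (∀ x, Fl (ΦXl x) = ΦYl (F l x)) ∧
      (∀ c, Fj ((1 : A') ⊗ₜ c) - (1 : A') ⊗ₜ f.left.appLE _ _ (inf₂_le_preimage f U U' hU' j l) c ∈
        𝔫' • (⊤ : Submodule A' (A' ⊗[k] Γ(Y.left, (U' j).1 ⊓ (U' l).1)))) ∧
      (∀ c, Fl ((1 : A') ⊗ₜ c) - (1 : A') ⊗ₜ f.left.appLE _ _ (inf₂_le_preimage f U U' hU' j l) c ∈
        𝔫' • (⊤ : Submodule A' (A' ⊗[k] Γ(Y.left, (U' j).1 ⊓ (U' l).1)))) ∧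
      (∀ c, Fl (ψX j l ((1 : A') ⊗ₜ c)) =
        ψY j l (Fj ((1 : A') ⊗ₜ c)) + ((e.symm 1 : ↥(J.restrictScalars k)) : A') ⊗ₜ δ c) ∧
      (∀ a c, δ (a + c) = δ a + δ c) ∧
      (∀ a c, δ (a * c) = f.left.appLE _ _ (inf₂_le_preimage f U U' hU' j l) a * δ c +
        f.left.appLE _ _ (inf₂_le_preimage f U U' hU' j l) c * δ a) ∧
      (∀ s : k, δ ((constToPresheaf X).app (op ((U j).1 ⊓ (U l).1)) s) = 0) ∧
      (∀ (r : Γ(X.left, (U j).1 ⊓ (U l).1)) (η : Γ(cotangentSheaf X, (U j).1 ⊓ (U l).1)),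
        ℓ (r • η) = f.left.appLE _ _ (inf₂_le_preimage f U U' hU' j l) r * ℓ η) ∧
      ∀ c, ℓ (dSection X _ c) = δ c := by
  have hle := inf₂_le_preimage f U U' hU' j l
  have hb' := inf_eq_basicOpen_appLE f U b hb U' hU'
  -- base-change maps
  obtain ⟨ΦXj, hΦXj⟩ := exists_baseChangeMap (A' := A') halgX (U j).1 ((U j).1 ⊓ (U l).1) inf_le_left
  obtain ⟨ΦXl, hΦXl⟩ := exists_baseChangeMap (A' := A') halgX (U l).1 ((U j).1 ⊓ (U l).1) inf_le_right
  obtain ⟨ΦYj, hΦYj⟩ := exists_baseChangeMap (A' := A') halgY (U' j).1 ((U' j).1 ⊓ (U' l).1) inf_le_left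
  obtain ⟨ΦYl, hΦYl⟩ := exists_baseChangeMap (A' := A') halgY (U' l).1 ((U' j).1 ⊓ (U' l).1) inf_le_right
  -- restrictions of the chart lifts
  obtain ⟨Fj, hFjΦ, hFj⟩ := exists_algHom_restrict₂ halgX halgY f 𝔫' (U j).2 (b j l) (hb j l) inf_le_left (U' j).2
    (hU' j).le (hb' j l) inf_le_left hle h𝔫 (F j) (hF j) hΦXj hΦYj
  obtain ⟨Fl, hFlΦ, hFl⟩ := exists_algHom_restrict₂ halgX halgY f 𝔫' (U l).2 (b l j)
    (by rw [inf_comm]; exact hb l j) inf_le_right (U' l).2 (hU' l).le (by rw [inf_comm]; exact hb' l j) inf_le_right hle h𝔫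
    (F l) (hF l) hΦXl hΦYl
  -- `f♯` on the overlap as a `k`-algebra map
  let g : Γ(X.left, (U j).1 ⊓ (U l).1) →ₐ[k] Γ(Y.left, (U' j).1 ⊓ (U' l).1) :=
    { (f.left.appLE _ _ hle).hom with commutes' := fun c => appLE_algebraMap_eq_algebraMap halgX halgY f hle c }
  -- the defect coordinate
  obtain ⟨δ, hδ, hδadd, hδmul, hδconst⟩ := exists_defectCoord halgX J hJ hJ𝔫 e g Fj Fl hFj (ψX j l) (ψY j l) (hψY j l)
    (hFψ j l ΦXj hΦXj ΦXl hΦXl ΦYj hΦYj ΦYl hΦYl Fj Fl hFjΦ hFlΦ)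
  -- its `1`-form reading
  obtain ⟨ℓ, hℓ, hℓd⟩ := exists_semilinear_lift_of_leibniz (f.left.appLE _ _ hle).hom (isAffineOpen_inf₂ U b hb j l) δ
    hδadd hδmul hδconst
  exact ⟨ΦXj, ΦXl, ΦYj, ΦYl, Fj, Fl, δ, ℓ, hΦXj, hΦXl, hΦYj, hΦYl, hFjΦ, hFlΦ, hFj, hFl, hδ, hδadd, hδmul, hδconst, hℓ, hℓd⟩

end Pair

/-! ## §4 Two restrictions of one chart lift to a common smaller principal open coincide -/

section TwoRestrictions

variable (𝔫' : Ideal A')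

include halgX halgY in
/-- **Independence of the intermediate open.**  Let `F : A' ⊗ Γ(X, V) → A' ⊗ Γ(Y, V′)` be a chart lift, `W₁, W₂ ⊆ V` with
restrictions `F₁, F₂` of `F`, and `W = D(s) ⊆ V` below both with further restrictions `T₁` (of `F₁`) and `T₂` (of `F₂`), all
characterised through base-change maps.  Then `T₁ = T₂` (both extend `F` through the localisation `Γ(V) → Γ(W)`).
[cite: Hartshorne2010, Thm. 10.2 (proof), p. 81] -/
theorem algHom_restrict_restrict_eq {V W₁ W₂ W : X.left.Opens} (hV : IsAffineOpen V) (s : Γ(X.left, V))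
    (hW : W = X.left.basicOpen s) (h : W ≤ V) (h₁ : W₁ ≤ V) (h₂ : W₂ ≤ V) (hW₁ : W ≤ W₁) (hW₂ : W ≤ W₂)
    {V' W₁' W₂' W' : Y.left.Opens} (h₁' : W₁' ≤ V') (h₂' : W₂' ≤ V') (hW₁' : W' ≤ W₁') (hW₂' : W' ≤ W₂')
    (F : A' ⊗[k] Γ(X.left, V) →ₐ[A'] A' ⊗[k] Γ(Y.left, V'))
    {Φ₁ : A' ⊗[k] Γ(X.left, V) →ₐ[A'] A' ⊗[k] Γ(X.left, W₁)}
    (hΦ₁ : ∀ a c, Φ₁ (a ⊗ₜ c) = a ⊗ₜ X.left.presheaf.map (homOfLE h₁).op c)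
    {Φ₂ : A' ⊗[k] Γ(X.left, V) →ₐ[A'] A' ⊗[k] Γ(X.left, W₂)}
    (hΦ₂ : ∀ a c, Φ₂ (a ⊗ₜ c) = a ⊗ₜ X.left.presheaf.map (homOfLE h₂).op c)
    {Ψ₁ : A' ⊗[k] Γ(X.left, W₁) →ₐ[A'] A' ⊗[k] Γ(X.left, W)}
    (hΨ₁ : ∀ a c, Ψ₁ (a ⊗ₜ c) = a ⊗ₜ X.left.presheaf.map (homOfLE hW₁).op c)
    {Ψ₂ : A' ⊗[k] Γ(X.left, W₂) →ₐ[A'] A' ⊗[k] Γ(X.left, W)}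
    (hΨ₂ : ∀ a c, Ψ₂ (a ⊗ₜ c) = a ⊗ₜ X.left.presheaf.map (homOfLE hW₂).op c)
    {Φ₁' : A' ⊗[k] Γ(Y.left, V') →ₐ[A'] A' ⊗[k] Γ(Y.left, W₁')}
    (hΦ₁' : ∀ a c, Φ₁' (a ⊗ₜ c) = a ⊗ₜ Y.left.presheaf.map (homOfLE h₁').op c)
    {Φ₂' : A' ⊗[k] Γ(Y.left, V') →ₐ[A'] A' ⊗[k] Γ(Y.left, W₂')}
    (hΦ₂' : ∀ a c, Φ₂' (a ⊗ₜ c) = a ⊗ₜ Y.left.presheaf.map (homOfLE h₂').op c)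
    {Ψ₁' : A' ⊗[k] Γ(Y.left, W₁') →ₐ[A'] A' ⊗[k] Γ(Y.left, W')}
    (hΨ₁' : ∀ a c, Ψ₁' (a ⊗ₜ c) = a ⊗ₜ Y.left.presheaf.map (homOfLE hW₁').op c)
    {Ψ₂' : A' ⊗[k] Γ(Y.left, W₂') →ₐ[A'] A' ⊗[k] Γ(Y.left, W')}
    (hΨ₂' : ∀ a c, Ψ₂' (a ⊗ₜ c) = a ⊗ₜ Y.left.presheaf.map (homOfLE hW₂').op c)
    {F₁ : A' ⊗[k] Γ(X.left, W₁) →ₐ[A'] A' ⊗[k] Γ(Y.left, W₁')} (hF₁ : ∀ x, F₁ (Φ₁ x) = Φ₁' (F x))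
    {F₂ : A' ⊗[k] Γ(X.left, W₂) →ₐ[A'] A' ⊗[k] Γ(Y.left, W₂')} (hF₂ : ∀ x, F₂ (Φ₂ x) = Φ₂' (F x))
    {T₁ T₂ : A' ⊗[k] Γ(X.left, W) →ₐ[A'] A' ⊗[k] Γ(Y.left, W')}
    (hT₁ : ∀ x, T₁ (Ψ₁ x) = Ψ₁' (F₁ x)) (hT₂ : ∀ x, T₂ (Ψ₂ x) = Ψ₂' (F₂ x)) (y : A' ⊗[k] Γ(X.left, W)) :
    T₁ y = T₂ y := by
  obtain ⟨Φ, hΦ⟩ := exists_baseChangeMap (A' := A') halgX V W h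
  have c₁ : ∀ x, Ψ₁ (Φ₁ x) = Φ x := fun x => baseChangeMap_comp_apply h₁ hW₁ hΦ₁ hΨ₁ hΦ x
  have c₂ : ∀ x, Ψ₂ (Φ₂ x) = Φ x := fun x => baseChangeMap_comp_apply h₂ hW₂ hΦ₂ hΨ₂ hΦ x
  obtain ⟨Φ', hΦ'⟩ := exists_baseChangeMap (A' := A') halgY V' W' (hW₁'.trans h₁')
  have c₁' : ∀ x, Ψ₁' (Φ₁' x) = Φ' x := fun x => baseChangeMap_comp_apply h₁' hW₁' hΦ₁' hΨ₁' hΦ' x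
  have c₂' : ∀ x, Ψ₂' (Φ₂' x) = Φ' x := fun x => baseChangeMap_comp_apply h₂' hW₂' hΦ₂' hΨ₂' hΦ' x
  refine algHom_restrict_ext halgX hV s hW h hΦ (P := T₁) (Q := T₂) (fun x => ?_) y
  calc T₁ (Φ x) = T₁ (Ψ₁ (Φ₁ x)) := by rw [c₁]
    _ = Φ' (F x) := by rw [hT₁, hF₁, c₁']
    _ = T₂ (Ψ₂ (Φ₂ x)) := by rw [hT₂, hF₂, c₂']
    _ = T₂ (Φ x) := by rw [c₂]

end TwoRestrictions

end Literature.AlgebraicGeometry.Deformation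

end
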